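import Mathlib
import Summits.ValiantsHypothesis.ValiantsHypothesis.Theorems.BarrierLeverPartitionMinorsHitByVPHiddenStatesPathTableGood
import Summits.ValiantsHypothesis.ValiantsHypothesis.Theorems.BarrierLeverPartitionMinorsHitByVPHiddenStatesPathTableInert
import Summits.ValiantsHypothesis.ValiantsHypothesis.Theorems.BarrierLeverPartitionMinorsHitByVPHiddenStatesPathTableCell

/-!
# Route BarrierLever — item `PartitionMinorsHitByVP` (stmt-ValiantsHypothesis-19717), line `hidden-states`:
# ★★ THE FIRST SHELL OF HALF-BALL, EVERY `t`: the classes `B_t(2t+1) − A + C` with `t − |A ∩ C| ≥ 2`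

Helper file (`--supports stmt-ValiantsHypothesis-19717`; cell valiant-natproofs, 𝒟-side door (c), registered line
`Cruxes/PartitionMinorsHitByVP/Lines/hidden_states.lean` v8; prover seat val-np-p6 gen 16).  Closes NO item; definition-free.
Memo HOME/val-np-p6/g16/MEMO-valnp6-g16.md: `P_k` (`…PathTableGood`) + inert coordinates (`…PathTableInert`: `Z = A ∩ C` forced present,
`W = (A ∪ C)ᶜ` forced absent) give, WITHOUT any section calculus,
★★ `exists_table_firstShell` — for every `t`, all `A, C ⊆ Fin (2t+1)` with `|A| = t`, `|C| = t+1` and `k = t − |A ∩ C| ≥ 2`, every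
injective row family `u` ranging in `B_t − {A} + {C}` (`u i = C` or `|u i| ≤ t ∧ u i ≠ A`) and every column family through which all points
`|J| ≤ t` occur: THERE IS A TABLE `tx` with `det [∏_{a ∈ u i} (tx none a + Σ_{q ∈ cols kk} tx (some q) a)] ≠ 0`;
★★ `gc_cell_firstShell` — the same in the shape of Conjecture GC½ (threshold column family at `h = 2t+1`, `r = 2^{2t}`).
(The down-sets of the first shell are exactly these with `A ⊄ C`; the two classes with `k = 1` per `t` are not covered here.)

HONEST LABEL: cells of the GC½ conjecture column; 19717 stays OPEN; nothing on crux 14610 or VP ≠ VNP.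
-/

set_option linter.dupNamespace false

namespace Summit.ValiantsHypothesis.ValiantsHypothesis.Theorems.BarrierLever.HiddenStates

open Finset

noncomputable section

namespace PathTable

/-- a four-part re-indexing: `(Fin (k+1) ⊕ Fin k) ⊕ (Fin j ⊕ Fin j) ≃ α` onto `C ∖ A`, `A ∖ C`, `A ∩ C`, `(A ∪ C)ᶜ`. -/
theorem exists_equiv_four {α : Type} [Fintype α] [DecidableEq α] (A C : Finset α) {k j : ℕ}
    (h1 : (C \ A).card = k + 1) (h2 : (A \ C).card = k) (h3 : (A ∩ C).card = j) (h4 : (A ∪ C)ᶜ.card = j) :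
    ∃ e : (Fin (k + 1) ⊕ Fin k) ⊕ (Fin j ⊕ Fin j) ≃ α,
      (∀ b, e (Sum.inl (Sum.inl b)) ∈ C \ A) ∧ (∀ i, e (Sum.inl (Sum.inr i)) ∈ A \ C) ∧
      (∀ z, e (Sum.inr (Sum.inl z)) ∈ A ∩ C) ∧ (∀ w, e (Sum.inr (Sum.inr w)) ∈ (A ∪ C)ᶜ) := by
  classical
  let e1 := ((C \ A).equivFinOfCardEq h1).symm
  let e2 := ((A \ C).equivFinOfCardEq h2).symm
  let e3 := ((A ∩ C).equivFinOfCardEq h3).symm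
  let e4 := ((A ∪ C)ᶜ.equivFinOfCardEq h4).symm
  let f : (Fin (k + 1) ⊕ Fin k) ⊕ (Fin j ⊕ Fin j) → α :=
    fun x => Sum.elim (Sum.elim (fun b => (e1 b).1) (fun i => (e2 i).1)) (Sum.elim (fun z => (e3 z).1) (fun w => (e4 w).1)) x
  have m1 : ∀ b, f (Sum.inl (Sum.inl b)) ∈ C \ A := fun b => (e1 b).2
  have m2 : ∀ i, f (Sum.inl (Sum.inr i)) ∈ A \ C := fun i => (e2 i).2
  have m3 : ∀ z, f (Sum.inr (Sum.inl z)) ∈ A ∩ C := fun z => (e3 z).2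
  have m4 : ∀ w, f (Sum.inr (Sum.inr w)) ∈ (A ∪ C)ᶜ := fun w => (e4 w).2
  have hinj : Function.Injective f := by
    intro x y hxy
    rcases x with (b | i) | (z | w) <;> rcases y with (b' | i') | (z' | w')
    all_goals first
      | (have hx := m1 b; have hy := m1 b') | (have hx := m1 b; have hy := m2 i') | (have hx := m1 b; have hy := m3 z')
      | (have hx := m1 b; have hy := m4 w')
      | (have hx := m2 i; have hy := m1 b') | (have hx := m2 i; have hy := m2 i') | (have hx := m2 i; have hy := m3 z')
      | (have hx := m2 i; have hy := m4 w')
      | (have hx := m3 z; have hy := m1 b') | (have hx := m3 z; have hy := m2 i') | (have hx := m3 z; have hy := m3 z')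
      | (have hx := m3 z; have hy := m4 w')
      | (have hx := m4 w; have hy := m1 b') | (have hx := m4 w; have hy := m2 i') | (have hx := m4 w; have hy := m3 z')
      | (have hx := m4 w; have hy := m4 w')
    all_goals rw [hxy] at hx
    all_goals simp only [Finset.mem_sdiff, Finset.mem_inter, Finset.mem_compl, Finset.mem_union, not_or] at hx hy
    · exact congrArg _ (congrArg _ (e1.injective (Subtype.ext hxy)))
    all_goals first | tauto | skip
    · exact congrArg _ (congrArg _ (e2.injective (Subtype.ext hxy)))
    · exact congrArg _ (congrArg _ (e3.injective (Subtype.ext hxy)))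
    · exact congrArg _ (congrArg _ (e4.injective (Subtype.ext hxy)))
  have hcard : Fintype.card ((Fin (k + 1) ⊕ Fin k) ⊕ (Fin j ⊕ Fin j)) = Fintype.card α := by
    simp only [Fintype.card_sum, Fintype.card_fin]
    have hCA : (C \ A).card + (A ∩ C).card = C.card := by
      rw [Finset.inter_comm]; exact Finset.card_sdiff_add_card_inter C A
    have hAC : (A \ C).card + (A ∩ C).card = A.card := Finset.card_sdiff_add_card_inter A C
    have hU : (A ∪ C).card + (A ∩ C).card = A.card + C.card := Finset.card_union_add_card_inter A C
    have hc : (A ∪ C)ᶜ.card = Fintype.card α - (A ∪ C).card := Finset.card_compl _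
    have hle : (A ∪ C).card ≤ Fintype.card α := Finset.card_le_univ _
    omega
  have hbij : Function.Bijective f := (Fintype.bijective_iff_injective_and_card f).2 ⟨hinj, hcard⟩
  exact ⟨Equiv.ofBijective f hbij, m1, m2, m3, m4⟩

/-- ★★ **THE FIRST SHELL OF HALF-BALL, classes with `k = t − |A ∩ C| ≥ 2`, every `t`.** -/
theorem exists_table_firstShell (t : ℕ) (A C : Finset (Fin (2 * t + 1))) (hA : A.card = t) (hC : C.card = t + 1)
    (hk : 2 ≤ t - (A ∩ C).card)
    {r : ℕ} (u cols : Fin r → Finset (Fin (2 * t + 1))) (hu : Function.Injective u)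
    (hU : ∀ i, ((u i).card ≤ t ∧ u i ≠ A) ∨ u i = C)
    (hcols : ∀ J : Finset (Fin (2 * t + 1)), J.card ≤ t → ∃ kk, cols kk = J) :
    ∃ tx : Option (Fin (2 * t + 1)) → Fin (2 * t + 1) → ℂ,
      (Matrix.of fun i kk : Fin r => ∏ a ∈ u i, (tx none a + ∑ q ∈ cols kk, tx (some q) a)).det ≠ 0 := by
  classical
  -- the parameters `k = t − j`, `j = |A ∩ C|`
  set j := (A ∩ C).card with hj
  have hjt : j ≤ t := by
    have := Finset.card_le_card (Finset.inter_subset_left : A ∩ C ⊆ A)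
    rw [hA] at this; exact this
  obtain ⟨k, hkdef⟩ : ∃ k, t = k + j := ⟨t - j, by omega⟩
  have hk2 : 2 ≤ k := by omega
  have h1 : (C \ A).card = k + 1 := by
    have := Finset.card_sdiff_add_card_inter C A; rw [Finset.inter_comm] at this; omega
  have h2 : (A \ C).card = k := by have := Finset.card_sdiff_add_card_inter A C; omega
  have h4 : (A ∪ C)ᶜ.card = j := by
    have hU := Finset.card_union_add_card_inter A C
    rw [Finset.card_compl, Fintype.card_fin]; omega
  obtain ⟨e, m1, m2, m3, m4⟩ := exists_equiv_four A C h1 h2 hj.symm h4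
  -- the inert extension of the path table
  let w : (Fin (k + 1) ⊕ Fin k) ⊕ (Fin j ⊕ Fin j) → (Fin (k + 1) ⊕ Fin k) ⊕ (Fin j ⊕ Fin j) → ℂ :=
    fun a q => match a, q with
      | Sum.inl a₁, Sum.inl q₁ => pw k 1 a₁ q₁
      | Sum.inl _, Sum.inr _ => 0
      | Sum.inr z, q => if q = Sum.inr z then 1 else 0
  let Z : Finset (Fin j ⊕ Fin j) := (Finset.univ : Finset (Fin j)).image Sum.inl
  have hZ : Z.card = j := by
    simp only [Z]; rw [Finset.card_image_of_injective _ Sum.inl_injective, Finset.card_univ, Fintype.card_fin]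
  -- rows and columns pulled back
  let rowS : Fin r → Finset ((Fin (k + 1) ⊕ Fin k) ⊕ (Fin j ⊕ Fin j)) := fun i => (u i).map e.symm.toEmbedding
  let colJ : Fin r → Finset ((Fin (k + 1) ⊕ Fin k) ⊕ (Fin j ⊕ Fin j)) := fun kk => (cols kk).map e.symm.toEmbedding
  -- images of `A` and `C`
  have hmem : ∀ x, (e x ∈ A ↔ x ∈ ((Finset.univ : Finset (Fin k)).image Sum.inr).disjSum Z) ∧
      (e x ∈ C ↔ x ∈ ((Finset.univ : Finset (Fin (k + 1))).image Sum.inl).disjSum Z) := by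
    intro x
    rcases x with (b | i) | (z | w')
    · have h := m1 b; rw [Finset.mem_sdiff] at h
      simp [Z, h.1, h.2]
    · have h := m2 i; rw [Finset.mem_sdiff] at h
      simp [Z, h.1, h.2]
    · have h := m3 z; rw [Finset.mem_inter] at h
      simp [Z, h.1, h.2]
    · have h := m4 w'; rw [Finset.mem_compl, Finset.mem_union, not_or] at h
      simp [Z, h.1, h.2]
  have hmapA : A.map e.symm.toEmbedding = ((Finset.univ : Finset (Fin k)).image Sum.inr).disjSum Z := by
    ext x; rw [Finset.mem_map_equiv, Equiv.symm_symm]; exact (hmem x).1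
  have hmapC : C.map e.symm.toEmbedding = ((Finset.univ : Finset (Fin (k + 1))).image Sum.inl).disjSum Z := by
    ext x; rw [Finset.mem_map_equiv, Equiv.symm_symm]; exact (hmem x).2
  have hinj : Function.Injective rowS := fun i i' hij => hu (Finset.map_injective _ hij)
  have hrow : ∀ i, ((rowS i).card ≤ k + Z.card ∧ rowS i ≠ ((Finset.univ : Finset (Fin k)).image Sum.inr).disjSum Z) ∨
      rowS i = ((Finset.univ : Finset (Fin (k + 1))).image Sum.inl).disjSum Z := by
    intro i
    rcases hU i with ⟨hc, hne⟩ | h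
    · left
      refine ⟨by simp only [rowS, Finset.card_map, hZ]; omega, fun h => hne ?_⟩
      rw [← hmapA] at h
      exact Finset.map_injective _ h
    · right; simp only [rowS, h, hmapC]
  have hcol : ∀ J : Finset ((Fin (k + 1) ⊕ Fin k) ⊕ (Fin j ⊕ Fin j)), J.card ≤ k + Z.card → ∃ kk, colJ kk = J := by
    intro J hJ
    obtain ⟨kk, hkk⟩ := hcols (J.map e.toEmbedding) (by rw [Finset.card_map]; omega)
    refine ⟨kk, ?_⟩
    simp only [colJ, hkk, Finset.map_map]
    convert Finset.map_refl (s := J)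
    ext x; simp
  have hdet := det_ne_zero_of_dual_inert (pw k 1) (ppot k) (pw_ne_zero k 1) (pw_self k 1) k
    ((Finset.univ : Finset (Fin k)).image Sum.inr) ((Finset.univ : Finset (Fin (k + 1))).image Sum.inl) (zk k 1)
    (fun R hR => zk_card_ne (by omega)) (fun S hS hX => lambda_row_eq_zero S hS hX) (lambda_Y_ne_zero hk2 one_ne_zero)
    Z w (fun _ _ => rfl) (fun _ _ => rfl) (fun _ _ => rfl) rowS colJ hinj hrow hcol
  refine ⟨fun o a => match o with | none => 0 | some q => w (e.symm a) (e.symm q), ?_⟩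
  convert hdet using 2
  ext i kk
  simp only [Matrix.of_apply, zero_add, rowS, colJ, Finset.prod_map, Finset.sum_map]
  rfl

/-- ★★ **THE FIRST-SHELL CELLS in the shape of Conjecture GC½** (threshold column family at the exact half). -/
theorem gc_cell_firstShell (t : ℕ) (A C : Finset (Fin (2 * t + 1))) (hA : A.card = t) (hC : C.card = t + 1)
    (hk : 2 ≤ t - (A ∩ C).card) {r : ℕ} (hr : r = 2 ^ (2 * t))
    (cols : Fin r → Finset (Fin (2 * t + 1))) (hinj : Function.Injective cols)
    (hthr : ∀ kk J, J ∉ Set.range cols →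
      ∑ q ∈ cols kk, (2 ^ (2 * t + 1) + 2 ^ (q : ℕ)) < ∑ q ∈ J, (2 ^ (2 * t + 1) + 2 ^ (q : ℕ)))
    (u : Fin r → Finset (Fin (2 * t + 1))) (hu : Function.Injective u)
    (hU : ∀ i, ((u i).card ≤ t ∧ u i ≠ A) ∨ u i = C) :
    ∃ tx : Option (Fin (2 * t + 1)) → Fin (2 * t + 1) → ℂ,
      (Matrix.of fun i kk : Fin r => ∏ a ∈ u i, (tx none a + ∑ q ∈ cols kk, tx (some q) a)).det ≠ 0 :=
  exists_table_firstShell t A C hA hC hk u cols hu hU (cols_cover_ball hr cols hinj hthr)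

end PathTable

end

end Summit.ValiantsHypothesis.ValiantsHypothesis.Theorems.BarrierLever.HiddenStates
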